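import Literature.Analysis.FunctionSpaces.LatticeDiffOpComp
import Literature.Analysis.FunctionSpaces.LatticePairing
import HarnessLib

/-!
# The algebra of rapidly decreasing symbols on the lattice: associativity, distributivity, scalar symbols

Continuation of `LatticeConvolutionAlgebra.lean` (`Lattice.sconv a b`, the symbol of the product of
two multipliers) and `LatticeDiffOpComp.lean` (`compLeft`, `compRight`). The symbol calculus needed
for the commutator of a periodic operator with a smooth cutoff (F. W. Warner, GTM 94 (1983), 6.32
(10)–(11): `L̃ ω₁ ũ = ω₁ L̃ ũ + M₁ ũ`, `M₁ = L̃ω₁ - ω₁L̃` of order one; and the locality statement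
6.32 (15), "`M₂` has support in `O₁` and `ũ = v₁` on `O₁`"):

* **symbols are determined by their action on the single modes** `δ₀ v`
  (`Lattice.conv_single_zero`, `Lattice.symb_ext`), which transports the (already proved)
  identities of the convolution action to identities of symbols:
  associativity `a ⋆ (b ⋆ c) = (a ⋆ b) ⋆ c` (`Lattice.sconv_assoc`), distributivity, the unit
  `delta 1`, and `T ∘ (a ⋆ b) = (T ∘ a) ⋆ b`;
* **scalar symbols** `Lattice.scal χ = (χ k) • 1` (the coefficient families of scalar cutoff
  functions acting on vector-valued families): they commute with every symbol
  (`Lattice.sconv_scal_comm`, on the torus `ω · b = b · ω`) and with constant maps, and their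
  derivatives are scalar (`Lattice.freqDeriv_scal`).

## References

* F. W. Warner, *Foundations of Differentiable Manifolds and Lie Groups*, GTM 94 (1983), 6.24,
  6.32 (10)–(16). [WarnerGTM94]
-/

open Filter Finset
open scoped ENNReal NNReal Topology

noncomputable section

namespace Literature.Analysis.FunctionSpaces

namespace Lattice

open Torus

variable {d : Type*} [Fintype d]
variable {V W X Y : Type*} [NormedAddCommGroup V] [NormedSpace ℂ V] [NormedAddCommGroup W]
  [NormedSpace ℂ W] [NormedAddCommGroup X] [NormedSpace ℂ X] [NormedAddCommGroup Y] [NormedSpace ℂ Y]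

/-! ### Symbols are determined by their action on single modes -/

/-- `(x ⋆ δ₀ v)(k) = x(k) v`: a symbol acting on the single mode `δ₀ v = Pi.single 0 v`. [folklore] -/
theorem conv_single_zero (x : (d → ℤ) → (V →L[ℂ] W)) (v : V) (k : d → ℤ) :
    conv x (Pi.single 0 v) k = x k v := by
  rw [conv_apply, tsum_eq_single 0]
  · simp
  · intro l hl; simp [Pi.single_eq_of_ne hl]

/-- The same as an identity of families. [folklore] -/
theorem conv_single_zero' (x : (d → ℤ) → (V →L[ℂ] W)) (v : V) :
    conv x (Pi.single 0 v) = fun k => x k v :=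
  funext fun k => conv_single_zero x v k

/-- **Two symbols with the same action on all single modes `δ₀ v` are equal.** [folklore] -/
theorem symb_ext {x y : (d → ℤ) → (V →L[ℂ] W)}
    (h : ∀ v : V, conv x (Pi.single 0 v) = conv y (Pi.single 0 v)) : x = y := by
  funext k; ext v
  rw [← conv_single_zero x v k, h v, conv_single_zero]

omit [NormedSpace ℂ V] in
/-- Single modes are tempered. [folklore] -/
theorem tempered_single (k₀ : d → ℤ) (v : V) : Tempered (Pi.single k₀ v : (d → ℤ) → V) :=
  (rapidDecay_single k₀ v).tempered

/-! ### Associativity, unit and distributivity of the symbol product -/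

section Algebra

variable [CompleteSpace W] [CompleteSpace X] [CompleteSpace Y]

/-- **Associativity of the symbol product** for rapidly decreasing symbols:
`a ⋆ (b ⋆ c) = (a ⋆ b) ⋆ c` (on the torus: `(ω₁(ω₂ω₃)) = ((ω₁ω₂)ω₃)`). [folklore] -/
theorem sconv_assoc {a : (d → ℤ) → (X →L[ℂ] Y)} (ha : RapidDecay a) {b : (d → ℤ) → (W →L[ℂ] X)}
    (hb : RapidDecay b) {c : (d → ℤ) → (V →L[ℂ] W)} (hc : RapidDecay c) :
    sconv a (sconv b c) = sconv (sconv a b) c :=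
  symb_ext fun v => by
    rw [← conv_conv ha (hb.sconv hc) (tempered_single 0 v), ← conv_conv hb hc (tempered_single 0 v),
      ← conv_conv (ha.sconv hb) hc (tempered_single 0 v),
      ← conv_conv ha hb ((tempered_single 0 v).conv hc)]

/-- The Kronecker symbol on the right: `a ⋆ δ(T) = a ∘ T`. [folklore] -/
theorem sconv_delta {a : (d → ℤ) → (W →L[ℂ] X)} (ha : RapidDecay a) (T : V →L[ℂ] W) :
    sconv a (delta T) = compRight a T :=
  symb_ext fun v => by
    rw [← conv_conv ha (rapidDecay_delta T) (tempered_single 0 v), delta_conv, conv_comp]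

/-- The Kronecker symbol on the left: `δ(T) ⋆ b = T ∘ b`. [folklore] -/
theorem delta_sconv (T : W →L[ℂ] X) {b : (d → ℤ) → (V →L[ℂ] W)} (hb : RapidDecay b) :
    sconv (delta T) b = compLeft T b :=
  symb_ext fun v => by
    rw [← conv_conv (rapidDecay_delta T) hb (tempered_single 0 v), delta_conv,
      comp_conv T hb (tempered_single 0 v)]

/-- The unit: `a ⋆ δ(1) = a`. [folklore] -/
theorem sconv_delta_one [CompleteSpace V] {a : (d → ℤ) → (V →L[ℂ] W)} (ha : RapidDecay a) :
    sconv a (delta (1 : V →L[ℂ] V)) = a := by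
  rw [sconv_delta ha]; funext k
  simp only [compRight, ContinuousLinearMap.one_def, ContinuousLinearMap.comp_id]

/-- A constant map passes through a symbol product: `T ∘ (a ⋆ b) = (T ∘ a) ⋆ b`. [folklore] -/
theorem compLeft_sconv (T : X →L[ℂ] Y) {a : (d → ℤ) → (W →L[ℂ] X)} (ha : RapidDecay a)
    {b : (d → ℤ) → (V →L[ℂ] W)} (hb : RapidDecay b) :
    compLeft T (sconv a b) = sconv (compLeft T a) b :=
  symb_ext fun v => by
    rw [← comp_conv T (ha.sconv hb) (tempered_single 0 v),
      ← conv_conv (ha.compLeft T) hb (tempered_single 0 v), ← conv_conv ha hb (tempered_single 0 v),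
      ← comp_conv T ha ((tempered_single 0 v).conv hb)]

/-- Distributivity on the left: `(a + a') ⋆ b = a ⋆ b + a' ⋆ b`. [folklore] -/
theorem add_sconv {a a' : (d → ℤ) → (W →L[ℂ] X)} (ha : RapidDecay a) (ha' : RapidDecay a')
    {b : (d → ℤ) → (V →L[ℂ] W)} (hb : RapidDecay b) :
    sconv (a + a') b = sconv a b + sconv a' b :=
  symb_ext fun v => by
    rw [← conv_conv (ha.add ha') hb (tempered_single 0 v), add_conv ha ha' ((tempered_single 0 v).conv hb),
      add_conv (ha.sconv hb) (ha'.sconv hb) (tempered_single 0 v), conv_conv ha hb (tempered_single 0 v),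
      conv_conv ha' hb (tempered_single 0 v)]

/-- Distributivity on the right: `a ⋆ (b + b') = a ⋆ b + a ⋆ b'`. [folklore] -/
theorem sconv_add {a : (d → ℤ) → (W →L[ℂ] X)} (ha : RapidDecay a) {b b' : (d → ℤ) → (V →L[ℂ] W)}
    (hb : RapidDecay b) (hb' : RapidDecay b') :
    sconv a (b + b') = sconv a b + sconv a b' :=
  symb_ext fun v => by
    rw [← conv_conv ha (hb.add hb') (tempered_single 0 v), add_conv hb hb' (tempered_single 0 v),
      conv_add ha ((tempered_single 0 v).conv hb) ((tempered_single 0 v).conv hb'),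
      add_conv (ha.sconv hb) (ha.sconv hb') (tempered_single 0 v), conv_conv ha hb (tempered_single 0 v),
      conv_conv ha hb' (tempered_single 0 v)]

omit [Fintype d] [CompleteSpace W] [CompleteSpace X] [CompleteSpace Y] in
/-- `(-a) ⋆ b = -(a ⋆ b)` (unconditionally). [folklore] -/
theorem neg_sconv (a : (d → ℤ) → (W →L[ℂ] X)) (b : (d → ℤ) → (V →L[ℂ] W)) :
    sconv (-a) b = -sconv a b := by
  funext k
  simp only [sconv_apply, Pi.neg_apply, ContinuousLinearMap.neg_comp, tsum_neg]

omit [Fintype d] [CompleteSpace W] [CompleteSpace X] [CompleteSpace Y] in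
/-- `a ⋆ (-b) = -(a ⋆ b)` (unconditionally). [folklore] -/
theorem sconv_neg (a : (d → ℤ) → (W →L[ℂ] X)) (b : (d → ℤ) → (V →L[ℂ] W)) :
    sconv a (-b) = -sconv a b := by
  funext k
  simp only [sconv_apply, Pi.neg_apply, ContinuousLinearMap.comp_neg, tsum_neg]

/-- `(a - a') ⋆ b = a ⋆ b - a' ⋆ b`. [folklore] -/
theorem sub_sconv {a a' : (d → ℤ) → (W →L[ℂ] X)} (ha : RapidDecay a) (ha' : RapidDecay a')
    {b : (d → ℤ) → (V →L[ℂ] W)} (hb : RapidDecay b) :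
    sconv (a - a') b = sconv a b - sconv a' b := by
  rw [sub_eq_add_neg, add_sconv ha (by simpa using ha'.const_smul (-1)) hb, neg_sconv, ← sub_eq_add_neg]

/-- `a ⋆ (b - b') = a ⋆ b - a ⋆ b'`. [folklore] -/
theorem sconv_sub {a : (d → ℤ) → (W →L[ℂ] X)} (ha : RapidDecay a) {b b' : (d → ℤ) → (V →L[ℂ] W)}
    (hb : RapidDecay b) (hb' : RapidDecay b') :
    sconv a (b - b') = sconv a b - sconv a b' := by
  rw [sub_eq_add_neg, sconv_add ha hb (by simpa using hb'.const_smul (-1)), sconv_neg, ← sub_eq_add_neg]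

/-- Finite sums on the left: `(∑ aᵢ) ⋆ b = ∑ aᵢ ⋆ b`. [folklore] -/
theorem finset_sum_sconv {ι : Type*} (F : Finset ι) {a : ι → (d → ℤ) → (W →L[ℂ] X)}
    (ha : ∀ i ∈ F, RapidDecay (a i)) {b : (d → ℤ) → (V →L[ℂ] W)} (hb : RapidDecay b) :
    sconv (∑ i ∈ F, a i) b = ∑ i ∈ F, sconv (a i) b := by
  classical
  induction F using Finset.induction_on with
  | empty =>
      funext k
      simp [sconv_apply]
  | insert i F hi ih =>
      rw [Finset.sum_insert hi, Finset.sum_insert hi,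
        add_sconv (ha i (Finset.mem_insert_self i F)) (RapidDecay.finset_sum F fun j hj =>
          ha j (Finset.mem_insert_of_mem hj)) hb, ih fun j hj => ha j (Finset.mem_insert_of_mem hj)]

/-- Finite sums on the right: `a ⋆ (∑ bᵢ) = ∑ a ⋆ bᵢ`. [folklore] -/
theorem sconv_finset_sum {ι : Type*} (F : Finset ι) {a : (d → ℤ) → (W →L[ℂ] X)} (ha : RapidDecay a)
    {b : ι → (d → ℤ) → (V →L[ℂ] W)} (hb : ∀ i ∈ F, RapidDecay (b i)) :
    sconv a (∑ i ∈ F, b i) = ∑ i ∈ F, sconv a (b i) := by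
  classical
  induction F using Finset.induction_on with
  | empty =>
      funext k
      simp [sconv_apply]
  | insert i F hi ih =>
      rw [Finset.sum_insert hi, Finset.sum_insert hi,
        sconv_add ha (hb i (Finset.mem_insert_self i F)) (RapidDecay.finset_sum F fun j hj =>
          hb j (Finset.mem_insert_of_mem hj)), ih fun j hj => hb j (Finset.mem_insert_of_mem hj)]

end Algebra

/-! ### Scalar symbols -/

/-- The **scalar symbol** `(χ k) • 1` of a scalar coefficient family `χ` (the Fourier coefficients
of a scalar cutoff function `ω`, acting on `V`-valued families by `ω · u`). [folklore] -/
def scal (χ : (d → ℤ) → ℂ) : (d → ℤ) → (V →L[ℂ] V) := fun k => χ k • (1 : V →L[ℂ] V)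

omit [Fintype d] in
/-- Unfolding of `scal`. [folklore] -/
@[simp] theorem scal_apply (χ : (d → ℤ) → ℂ) (k : d → ℤ) : (scal χ : (d → ℤ) → (V →L[ℂ] V)) k = χ k • 1 :=
  rfl

/-- Scalar symbols of rapidly decreasing families are rapidly decreasing. [folklore] -/
theorem _root_.Literature.Analysis.FunctionSpaces.Torus.RapidDecay.scal {χ : (d → ℤ) → ℂ}
    (hχ : RapidDecay χ) : RapidDecay (scal χ : (d → ℤ) → (V →L[ℂ] V)) :=
  hχ.of_norm_le_mul' (C := ‖(1 : V →L[ℂ] V)‖) fun k =>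
    (norm_smul_le (χ k) (1 : V →L[ℂ] V)).trans_eq (mul_comm _ _)

omit [Fintype d] in
/-- `scal` is additive. [folklore] -/
theorem scal_add (χ ψ : (d → ℤ) → ℂ) : (scal (χ + ψ) : (d → ℤ) → (V →L[ℂ] V)) = scal χ + scal ψ := by
  funext k; simp [add_smul]

omit [Fintype d] in
/-- `scal` is compatible with subtraction. [folklore] -/
theorem scal_sub (χ ψ : (d → ℤ) → ℂ) : (scal (χ - ψ) : (d → ℤ) → (V →L[ℂ] V)) = scal χ - scal ψ := by
  funext k; simp [sub_smul]

omit [Fintype d] in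
/-- **Derivatives of scalar symbols are scalar**: `∂_j (χ • 1) = (∂_j χ) • 1`. [folklore] -/
theorem freqDeriv_scal (j : d) (χ : (d → ℤ) → ℂ) :
    freqDeriv j (scal χ : (d → ℤ) → (V →L[ℂ] V)) = scal (freqDeriv j χ) := by
  funext k; simp [smul_smul]

omit [Fintype d] in
/-- The action of a scalar symbol: `(χ ⋆ c)(k) = ∑_l χ(k-l) • c(l)`. [folklore] -/
theorem conv_scal_apply (χ : (d → ℤ) → ℂ) (c : (d → ℤ) → V) (k : d → ℤ) :
    conv (scal χ) c k = ∑' l, χ (k - l) • c l := by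
  simp [conv_apply]

omit [Fintype d] in
/-- **Scalars commute with constant maps**: `T ∘ (χ • 1) = (χ • 1) ∘ T` (both are `χ • T`).
[folklore] -/
theorem compLeft_scal (T : V →L[ℂ] W) (χ : (d → ℤ) → ℂ) :
    compLeft T (scal χ) = compRight (scal χ) T := by
  funext k
  simp only [compLeft, compRight, scal_apply, ContinuousLinearMap.comp_smul, ContinuousLinearMap.smul_comp,
    ContinuousLinearMap.one_def, ContinuousLinearMap.comp_id, ContinuousLinearMap.id_comp]

omit [Fintype d] in
/-- **Scalar symbols commute with every symbol**: `a ⋆ (χ • 1) = (χ • 1) ⋆ a` (on the torus,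
`b(x) ω(x) = ω(x) b(x)`; on the lattice, re-index `l ↦ k - l`). [folklore] -/
theorem sconv_scal_comm (a : (d → ℤ) → (V →L[ℂ] W)) (χ : (d → ℤ) → ℂ) :
    sconv a (scal χ) = sconv (scal χ) a := by
  funext k
  simp only [sconv_apply, scal_apply, ContinuousLinearMap.comp_smul, ContinuousLinearMap.smul_comp,
    ContinuousLinearMap.comp_id, ContinuousLinearMap.id_comp, ContinuousLinearMap.one_def]
  rw [show (fun l => χ (k - l) • a l) = fun l => (fun m => χ m • a (k - m)) (k - l) from
    funext fun l => by simp only [sub_sub_cancel]]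
  exact (tsum_sub_left_eq (fun m => χ m • a (k - m)) k).symm

section ScalConv

variable [CompleteSpace V] [CompleteSpace W]

/-- A constant map commutes with a scalar multiplier: `T (χ ⋆ c) = χ ⋆ (T c)` for tempered `c`.
[folklore] -/
theorem comp_conv_scal (T : V →L[ℂ] W) {χ : (d → ℤ) → ℂ} (hχ : RapidDecay χ) {c : (d → ℤ) → V}
    (hc : Tempered c) :
    (fun k => T (conv (scal χ) c k)) = conv (scal χ) fun k => T (c k) := by
  rw [comp_conv T hχ.scal hc, compLeft_scal, ← conv_comp]

/-- **A multiplier commutes with a scalar multiplier**: `a ⋆ (χ ⋆ c) = χ ⋆ (a ⋆ c)` for rapidly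
decreasing `a, χ` and tempered `c`. [folklore] -/
theorem conv_conv_scal {a : (d → ℤ) → (V →L[ℂ] W)} (ha : RapidDecay a) {χ : (d → ℤ) → ℂ}
    (hχ : RapidDecay χ) {c : (d → ℤ) → V} (hc : Tempered c) :
    conv a (conv (scal χ) c) = conv (scal χ) (conv a c) := by
  rw [conv_conv ha hχ.scal hc, sconv_scal_comm, ← conv_conv hχ.scal ha hc]

end ScalConv

end Lattice

end Literature.Analysis.FunctionSpaces
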